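import Summits.HubbardSuperconductivity.HubbardSuperconductivity.Theses.KacWindowPenalty
import Summits.HubbardSuperconductivity.HubbardSuperconductivity.Theses.DeformationLadder
import Literature.MathematicalPhysics.QuantumLattice.PairFieldMomentum
import Summits.HubbardSuperconductivity.HubbardSuperconductivity.Theorems.KacWindowPenaltyWindowGapPenalisedForms
import Summits.HubbardSuperconductivity.HubbardSuperconductivity.Theorems.DeformationLadderDeformedRung

/-!
# Route `KacWindowPenalty` — crux `WindowGap` (stmt-HubbardSuperconductivity-1088):
# positive calibration — the crux's inequality HOLDS for the BCS-deformed family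

The crux `WindowGap` asks for an extensive excess `λ(Cε + a)L²` of the Kac-window-penalised sector
energy `minEnergyOn (H_L + λW_ε) K_L` over `minEnergyOn H_L K_L` for the PURE torus
`H_L = hubbardTorus 2 L 1 U` (`K_L = szSector N_L 0`, `N_L = 2⌊(1−δ)L²/2⌋`,
`W_ε = L⁻² Σ_{|q_m| ≤ ε} Δ_d(m)ᴴ Δ_d(m)`). This module proves — kernel-closed, no physics input — that
the SAME inequality holds when `H_L` is replaced by the BCS-deformed torus of route
`DeformationLadder`, `K_L(U, g) = hubbardTorus 2 L 1 U − (g/L²) pFᴴ pF` (`pF = pairField dWaveFormFactor L`),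
for every `g > 0`, every `δ ∈ (0, 1/2)` and all `U ∈ (0, U₀(g, δ))`; indeed in the `(λ, a)`-UNIFORM-in-`ε`
form (`windowGap_deformed_uniform`), which `not_windowGap_uniform` (`Theorems/WindowGap/Negative/
TwistCeiling.lean`) REFUTES for the pure model, and hence in the crux's own quantifier shape
(`windowGap_deformed_cruxShape`).

Proof (three landed ingredients): (i) the window dominates its zero mode
(`re_expect_pairField_div_le_re_dotProduct_kacWindow_mulVec`), so `K(g) + λW_ε ≥ K(g − λ)` as
quadratic forms (`re_deformed_sub_le_re_deformed_add_kacWindow`); (ii) with `λ = g/2` the window gap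
is at least `E_L(g/2) − E_L(g)`, which the right chord of the concave sector energy at a ground state of
`K(g/2)` (`order_le_rightChord`) bounds below by `(g/2)L⁻² Re⟨pFᴴ pF⟩`; (iii) `deformedRung_proof`
(stmt-HubbardSuperconductivity-1894, closed) gives every-ground-state LRO `Re⟨pFᴴ pF⟩ ≥ aL⁴` at
coupling `g/2` for `U < U₀(g/2, δ)`.

Reading. The window-penalty bookkeeping of the route is sound wherever a `d`-wave condensate is
PROVED: the mean-field attraction pins the condensate at `q = 0` (no Goldstone branch, no twist
loophole), which is exactly why the ε-uniform form holds here and fails for the pure model — a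
calibration of the route's algebra, not of its physics (ideator 5, `Cruxes/WindowGap/EngineAudit-r2-k5.md`
§6; strategist census §3 T3). Supports for the crux (`--supports stmt-HubbardSuperconductivity-1088`).
H. Tasaki (2020) §2.1; R. Griffiths, Phys. Rev. 152 (1966) 240 §II (chords of concave energies).
No new definitions.
-/

-- the mandated namespace repeats `HubbardSuperconductivity` (single-problem summit, D-0017)
set_option linter.dupNamespace false

namespace Summit.HubbardSuperconductivity.HubbardSuperconductivity.Theorems

open Matrix Literature.MathematicalPhysics.QuantumLattice Literature.Probability.LatticeModels
open Summit.HubbardSuperconductivity.TwTipContinuation.Negative (exists_unit_groundState order_le_rightChord)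

/-- **The window dominates the deformation it competes with.** For `λ ≥ 0` and every Fock vector
`ψ`: `Re⟨ψ, (H − ((g−λ)/L²) pFᴴpF) ψ⟩ ≤ Re⟨ψ, (H − (g/L²) pFᴴpF + λ W_ε) ψ⟩`, i.e.
`K(g) + λW_ε ≥ K(g − λ)` as quadratic forms: the Kac window contains its zero mode,
`Re⟨ψ, pFᴴpF ψ⟩/L² ≤ Re⟨ψ, W_ε ψ⟩` (`re_expect_pairField_div_le_re_dotProduct_kacWindow_mulVec`).
Tasaki (2020) §2.1. [folklore] -/
theorem re_deformed_sub_le_re_deformed_add_kacWindow (L : ℕ) [NeZero L] (U g lam ε : ℝ)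
    (hlam : 0 ≤ lam) (ψ : Fock (Orb (FermionTorus 2 L))) :
    (star ψ ⬝ᵥ (hubbardTorus 2 L 1 U -
        (((g - lam) / (L : ℝ) ^ 2 : ℝ) : ℂ) •
          (Matrix.conjTranspose (pairField dWaveFormFactor L) * pairField dWaveFormFactor L)) *ᵥ ψ).re ≤
      (star ψ ⬝ᵥ (hubbardTorus 2 L 1 U -
        ((g / (L : ℝ) ^ 2 : ℝ) : ℂ) •
          (Matrix.conjTranspose (pairField dWaveFormFactor L) * pairField dWaveFormFactor L) +
        (lam : ℂ) • (∑ m : Fin 2 → ZMod L,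
          if (2 * Real.pi / (L : ℝ)) ^ 2 * (∑ i : Fin 2, (((m i).valMinAbs : ℤ) : ℝ) ^ 2) ≤ ε ^ 2 then
            ((L : ℂ) ^ 2)⁻¹ •
              (Matrix.conjTranspose (pairFieldAt dWaveFormFactor L m) * pairFieldAt dWaveFormFactor L m)
          else 0)) *ᵥ ψ).re := by
  have key := re_expect_pairField_div_le_re_dotProduct_kacWindow_mulVec L ε ψ
  simp only [expect] at key
  simp only [Matrix.sub_mulVec, Matrix.add_mulVec, Matrix.smul_mulVec, dotProduct_add, dotProduct_sub,
    dotProduct_smul, smul_eq_mul, Complex.add_re, Complex.sub_re, Complex.re_ofReal_mul]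
  set p := (star ψ ⬝ᵥ (Matrix.conjTranspose (pairField dWaveFormFactor L) * pairField dWaveFormFactor L) *ᵥ ψ).re
  set w := (star ψ ⬝ᵥ (∑ m : Fin 2 → ZMod L,
          if (2 * Real.pi / (L : ℝ)) ^ 2 * (∑ i : Fin 2, (((m i).valMinAbs : ℤ) : ℝ) ^ 2) ≤ ε ^ 2 then
            ((L : ℂ) ^ 2)⁻¹ •
              (Matrix.conjTranspose (pairFieldAt dWaveFormFactor L m) * pairFieldAt dWaveFormFactor L m)
          else 0) *ᵥ ψ).re
  have key' : p / (L : ℝ) ^ 2 ≤ w := key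
  have h1 : lam * (p / (L : ℝ) ^ 2) ≤ lam * w := mul_le_mul_of_nonneg_left key' hlam
  have h2 : (g - lam) / (L : ℝ) ^ 2 * p = g / (L : ℝ) ^ 2 * p - lam * (p / (L : ℝ) ^ 2) := by ring
  linarith

/-- **The crux's inequality for the BCS-deformed family, `(λ, a)`-uniformly in `ε`.** For every
`g > 0` and `δ ∈ (0, 1/2)` there is `U₀ > 0` such that for all `U ∈ (0, U₀)` some `λ, a > 0` serve EVERY
tail allowance `C ≥ 0` and EVERY window radius `ε > 0` with `Cε ≤ a`: eventually in even `L`,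
`λ(Cε + a)L² ≤ minEnergyOn (K_L(U,g) + λW_ε) K_L − minEnergyOn (K_L(U,g)) K_L`,
`K_L(U,g) = hubbardTorus 2 L 1 U − (g/L²) pFᴴpF`. Take `λ = g/2`, `a = a'/2` with `a'` the every-GS
order constant of `deformedRung_proof` at coupling `g/2`: domination
(`re_deformed_sub_le_re_deformed_add_kacWindow`) gives `minE(K(g)+λW_ε|K) ≥ minE(K(g/2)|K)`, and the
right chord at a unit ground state `φ` of `K(g/2)` (`order_le_rightChord`) gives
`minE(K(g/2)|K) − minE(K(g)|K) ≥ (g/2)L⁻² Re⟨φ, pFᴴpF φ⟩ ≥ (g/2) a' L²`. For the PURE torus this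
uniform form is false (`not_windowGap_uniform`). Griffiths (1966) §II; Tasaki (2020) §2.1. [folklore] -/
theorem windowGap_deformed_uniform :
    ∀ g : ℝ, 0 < g → ∀ δ ∈ Set.Ioo (0:ℝ) (1 / 2), ∃ U₀ : ℝ, 0 < U₀ ∧ ∀ U ∈ Set.Ioo (0:ℝ) U₀,
      ∃ lam a : ℝ, 0 < lam ∧ 0 < a ∧ ∀ C : ℝ, 0 ≤ C → ∀ ε : ℝ, 0 < ε → C * ε ≤ a →
        ∃ L₀ : ℕ, ∀ (L : ℕ) [NeZero L], L₀ ≤ L → Even L →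
          lam * (C * ε + a) * (L : ℝ) ^ 2 ≤
            (hubbardTorus 2 L 1 U -
                ((g / (L : ℝ) ^ 2 : ℝ) : ℂ) •
                  (Matrix.conjTranspose (pairField dWaveFormFactor L) * pairField dWaveFormFactor L) +
              (lam : ℂ) • (∑ m : Fin 2 → ZMod L,
                if (2 * Real.pi / (L : ℝ)) ^ 2 * (∑ i : Fin 2, (((m i).valMinAbs : ℤ) : ℝ) ^ 2) ≤ ε ^ 2 then
                  ((L : ℂ) ^ 2)⁻¹ •
                    (Matrix.conjTranspose (pairFieldAt dWaveFormFactor L m) * pairFieldAt dWaveFormFactor L m)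
                else 0)).minEnergyOn (szSector (2 * ⌊(1 - δ) * (L : ℝ) ^ 2 / 2⌋₊) 0) -
            (hubbardTorus 2 L 1 U -
                ((g / (L : ℝ) ^ 2 : ℝ) : ℂ) •
                  (Matrix.conjTranspose (pairField dWaveFormFactor L) * pairField dWaveFormFactor L)).minEnergyOn
              (szSector (2 * ⌊(1 - δ) * (L : ℝ) ^ 2 / 2⌋₊) 0) := by
  intro g hg δ hδ
  obtain ⟨U₀, hU₀, hDR⟩ := deformedRung_proof (g / 2) (half_pos hg) δ hδ
  refine ⟨U₀, hU₀, fun U hU => ?_⟩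
  obtain ⟨a, ha, L₀, hL⟩ := hDR U ⟨hU.1.le, hU.2⟩
  refine ⟨g / 2, a / 2, half_pos hg, half_pos ha, fun C hC ε hε hCε => ⟨L₀, fun L _ hLL _ => ?_⟩⟩
  have hn : ⌊(1 - δ) * (L : ℝ) ^ 2 / 2⌋₊ ≤ Fintype.card (FermionTorus 2 L) := by
    rw [show Fintype.card (FermionTorus 2 L) = L ^ 2 by simp]
    exact Summit.HubbardSuperconductivity.NoGo.floor_pairNumber_le δ (by linarith [hδ.1]) L
  obtain ⟨φ, hφ1, hφgs⟩ := exists_unit_groundState U (g / 2) L hn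
  have hLRO : a ≤ (expect ((pairField dWaveFormFactor L)ᴴ * pairField dWaveFormFactor L) φ).re / (L : ℝ) ^ 4 :=
    hL L hLL φ hφ1 hφgs
  have hchord := order_le_rightChord (U := U) (L := L) (show g / 2 < g by linarith) hφ1 hφgs
  -- domination: the penalised `K(g)` lies above `K(g/2)` on the sector
  have hdom : (hubbardTorus 2 L 1 U -
        (((g / 2) / (L : ℝ) ^ 2 : ℝ) : ℂ) •
          ((pairField dWaveFormFactor L)ᴴ * pairField dWaveFormFactor L)).minEnergyOn
          (szSector (2 * ⌊(1 - δ) * (L : ℝ) ^ 2 / 2⌋₊) 0) ≤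
      (hubbardTorus 2 L 1 U -
          ((g / (L : ℝ) ^ 2 : ℝ) : ℂ) •
            (Matrix.conjTranspose (pairField dWaveFormFactor L) * pairField dWaveFormFactor L) +
        (((g / 2 : ℝ)) : ℂ) • (∑ m : Fin 2 → ZMod L,
          if (2 * Real.pi / (L : ℝ)) ^ 2 * (∑ i : Fin 2, (((m i).valMinAbs : ℤ) : ℝ) ^ 2) ≤ ε ^ 2 then
            ((L : ℂ) ^ 2)⁻¹ •
              (Matrix.conjTranspose (pairFieldAt dWaveFormFactor L m) * pairFieldAt dWaveFormFactor L m)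
          else 0)).minEnergyOn (szSector (2 * ⌊(1 - δ) * (L : ℝ) ^ 2 / 2⌋₊) 0) := by
    change _ ≤ sInf _
    refine le_csInf ⟨_, φ, hφgs.1, hφ1, rfl⟩ ?_
    rintro b ⟨ψ, hψK, hψ, rfl⟩
    refine (minEnergyOn_le_re_rayleigh _ _ hψK hψ).trans ?_
    have := re_deformed_sub_le_re_deformed_add_kacWindow L U g (g / 2) ε (half_pos hg).le ψ
    rwa [show g - g / 2 = g / 2 by ring] at this
  have hLpos : (0 : ℝ) < (L : ℝ) := by exact_mod_cast Nat.pos_of_ne_zero (NeZero.ne L)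
  have hL2 : (0 : ℝ) < (L : ℝ) ^ 2 := by positivity
  have hL4 : (0 : ℝ) < (L : ℝ) ^ 4 := by positivity
  set p := (expect ((pairField dWaveFormFactor L)ᴴ * pairField dWaveFormFactor L) φ).re with hp_def
  have hp : a * (L : ℝ) ^ 4 ≤ p := (le_div_iff₀ hL4).1 hLRO
  have hE : (g - g / 2) / (L : ℝ) ^ 2 * p ≤
      (hubbardTorus 2 L 1 U -
        (((g / 2) / (L : ℝ) ^ 2 : ℝ) : ℂ) •
          ((pairField dWaveFormFactor L)ᴴ * pairField dWaveFormFactor L)).minEnergyOn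
          (szSector (2 * ⌊(1 - δ) * (L : ℝ) ^ 2 / 2⌋₊) 0) -
        (hubbardTorus 2 L 1 U -
          ((g / (L : ℝ) ^ 2 : ℝ) : ℂ) •
            ((pairField dWaveFormFactor L)ᴴ * pairField dWaveFormFactor L)).minEnergyOn
          (szSector (2 * ⌊(1 - δ) * (L : ℝ) ^ 2 / 2⌋₊) 0) := hchord
  have h3 : g / 2 * (C * ε + a / 2) * (L : ℝ) ^ 2 ≤ g / 2 * a * (L : ℝ) ^ 2 := by
    apply mul_le_mul_of_nonneg_right _ hL2.le
    exact mul_le_mul_of_nonneg_left (by linarith) (half_pos hg).le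
  have h4 : g / 2 * a * (L : ℝ) ^ 2 ≤ (g - g / 2) / (L : ℝ) ^ 2 * p := by
    have h44 : g / 2 * (a * (L : ℝ) ^ 4) ≤ g / 2 * p := mul_le_mul_of_nonneg_left hp (half_pos hg).le
    have key : (g - g / 2) / (L : ℝ) ^ 2 * p = (g / 2 * p) / (L : ℝ) ^ 2 := by ring
    rw [key, le_div_iff₀ hL2]
    calc g / 2 * a * (L : ℝ) ^ 2 * (L : ℝ) ^ 2 = g / 2 * (a * (L : ℝ) ^ 4) := by ring
      _ ≤ g / 2 * p := h44
  -- `Matrix.conjTranspose X` and `Xᴴ` are the same term; align the two spellings for `linarith`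
  change g / 2 * (C * ε + a / 2) * (L : ℝ) ^ 2 ≤
      (hubbardTorus 2 L 1 U -
          ((g / (L : ℝ) ^ 2 : ℝ) : ℂ) •
            ((pairField dWaveFormFactor L)ᴴ * pairField dWaveFormFactor L) +
        (((g / 2 : ℝ)) : ℂ) • (∑ m : Fin 2 → ZMod L,
          if (2 * Real.pi / (L : ℝ)) ^ 2 * (∑ i : Fin 2, (((m i).valMinAbs : ℤ) : ℝ) ^ 2) ≤ ε ^ 2 then
            ((L : ℂ) ^ 2)⁻¹ •
              (Matrix.conjTranspose (pairFieldAt dWaveFormFactor L m) * pairFieldAt dWaveFormFactor L m)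
          else 0)).minEnergyOn (szSector (2 * ⌊(1 - δ) * (L : ℝ) ^ 2 / 2⌋₊) 0) -
      (hubbardTorus 2 L 1 U -
          ((g / (L : ℝ) ^ 2 : ℝ) : ℂ) •
            ((pairField dWaveFormFactor L)ᴴ * pairField dWaveFormFactor L)).minEnergyOn
        (szSector (2 * ⌊(1 - δ) * (L : ℝ) ^ 2 / 2⌋₊) 0)
  linarith

/-- **The calibration in the crux's own quantifier shape.** The body of `KacWindowPenalty.WindowGap`
with the pure torus `hubbardTorus 2 L 1 U` replaced by the BCS-deformed torus
`K_L(U,g) = hubbardTorus 2 L 1 U − (g/L²) pFᴴpF` holds for every `g > 0`, every `δ ∈ (0, 1/2)` and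
all `U ∈ (0, U₀(g, δ))`: `∀ C ≥ 0 ∀ ε₀ > 0 ∃ ε ∈ (0, ε₀] ∃ λ a > 0 ∃ L₀ ∀ even L ≥ L₀,
λ(Cε + a)L² ≤ minEnergyOn (K_L(U,g) + λW_ε) K_L − minEnergyOn (K_L(U,g)) K_L` (from
`windowGap_deformed_uniform` with `ε = min ε₀ (a/(C+1))`). So the route's sandwich algebra is exact
where a `q = 0`-pinned `d`-wave condensate is proved; what the pure model lacks is the condensate, not
the bookkeeping. Griffiths (1966) §II; Tasaki (2020) §2.1. [folklore] -/
theorem windowGap_deformed_cruxShape :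
    ∀ g : ℝ, 0 < g → ∀ δ ∈ Set.Ioo (0:ℝ) (1 / 2), ∃ U₀ : ℝ, 0 < U₀ ∧ ∀ U ∈ Set.Ioo (0:ℝ) U₀,
      ∀ C : ℝ, 0 ≤ C → ∀ ε₀ : ℝ, 0 < ε₀ → ∃ ε ∈ Set.Ioc (0:ℝ) ε₀, ∃ lam a : ℝ, 0 < lam ∧ 0 < a ∧
        ∃ L₀ : ℕ, ∀ (L : ℕ) [NeZero L], L₀ ≤ L → Even L →
          lam * (C * ε + a) * (L : ℝ) ^ 2 ≤
            (hubbardTorus 2 L 1 U -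
                ((g / (L : ℝ) ^ 2 : ℝ) : ℂ) •
                  (Matrix.conjTranspose (pairField dWaveFormFactor L) * pairField dWaveFormFactor L) +
              (lam : ℂ) • (∑ m : Fin 2 → ZMod L,
                if (2 * Real.pi / (L : ℝ)) ^ 2 * (∑ i : Fin 2, (((m i).valMinAbs : ℤ) : ℝ) ^ 2) ≤ ε ^ 2 then
                  ((L : ℂ) ^ 2)⁻¹ •
                    (Matrix.conjTranspose (pairFieldAt dWaveFormFactor L m) * pairFieldAt dWaveFormFactor L m)
                else 0)).minEnergyOn (szSector (2 * ⌊(1 - δ) * (L : ℝ) ^ 2 / 2⌋₊) 0) -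
            (hubbardTorus 2 L 1 U -
                ((g / (L : ℝ) ^ 2 : ℝ) : ℂ) •
                  (Matrix.conjTranspose (pairField dWaveFormFactor L) * pairField dWaveFormFactor L)).minEnergyOn
              (szSector (2 * ⌊(1 - δ) * (L : ℝ) ^ 2 / 2⌋₊) 0) := by
  intro g hg δ hδ
  obtain ⟨U₀, hU₀, h⟩ := windowGap_deformed_uniform g hg δ hδ
  refine ⟨U₀, hU₀, fun U hU C hC ε₀ hε₀ => ?_⟩
  obtain ⟨lam, a, hlam, ha, hall⟩ := h U hU
  have hCp : 0 < C + 1 := by linarith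
  set ε := min ε₀ (a / (C + 1)) with hε_def
  have hεpos : 0 < ε := lt_min hε₀ (div_pos ha hCp)
  have hεle : ε ≤ ε₀ := min_le_left _ _
  have hCε : C * ε ≤ a := by
    have h1 : ε ≤ a / (C + 1) := min_le_right _ _
    have h2 : C * ε ≤ C * (a / (C + 1)) := mul_le_mul_of_nonneg_left h1 hC
    have h3 : C * (a / (C + 1)) ≤ a := by
      rw [mul_div_assoc', div_le_iff₀ hCp]; nlinarith
    linarith
  obtain ⟨L₀, hL⟩ := hall C hC ε hεpos hCε
  exact ⟨ε, ⟨hεpos, hεle⟩, lam, a, hlam, ha, L₀, fun L _ hLL hE => hL L hLL hE⟩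

end Summit.HubbardSuperconductivity.HubbardSuperconductivity.Theorems
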